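import Mathlib.Analysis.SpecialFunctions.Pow.Real
import Mathlib.Analysis.SpecialFunctions.Sqrt
import Mathlib.Tactic
import HarnessLib
import Literature.MathematicalPhysics.QuantumManyBody.ExtendedHubbardDimerEffectiveU
import Literature.MathematicalPhysics.QuantumLattice.HubbardRingExchangeDictionary

/-!
# From measured exchange constants to a one-band Hubbard `(t, U)`: the printed fourth-order maps
# and their EXACT inversions (square lattice: Coldea et al. 2001; two-leg ladder: Notbohm et al. 2007)

Two inelastic-neutron papers convert FITTED exchange constants of a spin Hamiltonian into the
parameters of a ONE-BAND Hubbard model through the strong-coupling expansion to fourth order in `t/U`: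

* SQUARE LATTICE, La₂CuO₄ [ColdeaEtAl2001, p. 3 (arXiv:cond-mat/0006384 chunk p0003 L80–95)]:
  «If the perturbation series is expanded to order `t⁴` (i.e. 4 hops) one regains the Hamiltonian (1) with
  the exchange constants `J = 4t²/U − 24t⁴/U³`, `J_c = 80t⁴/U³` and `J′ = J″ = 4t⁴/U³`
  [Takahashi77, Roger89, MacDonald90]. We again fitted the dispersion … we obtained `t = 0.33 ± 0.02` eV
  and `U = 2.9 ± 0.4` eV (`T` = 295 K) … The corresponding exchange values are `J = 138.3 ± 4` meV,
  `J_c = 38 ± 8` meV and `J′ = J″ = J_c/20 = 2 ± 0.5` meV (the parameters at `T` = 10 K are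
  `t = 0.30 ± 0.02` eV, `U = 2.2 ± 0.4` eV, `J = 146.3 ± 4` meV and `J_c = 61 ± 8` meV).»
  (`J_c` multiplies `(S_i·S_j)(S_k·S_l) + (S_i·S_l)(S_k·S_j) − (S_i·S_k)(S_j·S_l)` summed over plaquettes,
  their Eq. (1).)
* TWO-LEG LADDER, La₄Sr₁₀Cu₂₄O₄₁ [NotbohmEtAl2007, p. 4 L43 and note [Hubbard] (arXiv:cond-mat/0608109
  chunks p0004 L43, p0005 L1–4)]: «Approximate parameters for (1), `t_leg = 0.42`, `t_rung = 0.34`,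
  `U = 3.72` eV, follow from low order perturbation theory»; note: «Parameters to `O(κ⁴)`:
  `J_leg = 4t_leg²/U + O(κ⁴)`, `J_rung = 4t_rung²/U + O(κ⁴)`, `J_cyc = 80 t_leg² t_rung²/U³`», with the
  fitted `J_leg = 186`, `J_rung = 124`, `J_cyc = 31` meV (their abstract).

WHAT IS TYPED AND PROVED HERE (`0` facts; the physics input is the pair of printed formulas, entered as
definitions; everything else is algebra over `ℝ`):

* §1 the square-lattice map `(t, U) ↦ (J, J_c, J′)` AS PRINTED and its CLOSED-FORM INVERSE
  `U = 5 (J + 3J_c/10)² / J_c`, `t = ½ √(U (J + 3J_c/10))` (`sqU`, `sqT`): round trip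
  (`sqJc_sqT_sqU`, `sqJ_sqT_sqU`), UNIQUENESS among `t, U > 0` (`sq_inverse_unique`), the RATIO LAW
  `(U/t)² = 20 (J/J_c + 3/10)` — the fitted `U/t` is a function of the ratio `J_c/J` ALONE
  (`sq_ratio_law`), strict DECREASE of `U` in `J_c` at fixed `J` on `0 < J_c < 10J/3` (`sqU_strictAntiOn`),
  and `J′ = J″ = J_c/20` (`sqJ2_eq`). KERNEL CERTIFICATES reproduce the printed numbers from the printed
  exchanges: `(J, J_c) = (146.3, 61)` meV ⇒ `2220 < U < 2222` meV, `302 < t < 302.5` meV (printed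
  `2.2 ± 0.4` eV, `0.30 ± 0.02` eV); `(138.3, 38)` ⇒ `2948 < U < 2950`, `332 < t < 332.5` (printed `2.9`, `0.33`).
* §2 the ladder map AS PRINTED (leading order for `J_leg`, `J_rung`; fourth order for `J_cyc`) and its
  inverse `U = 5 J_leg J_rung / J_cyc`, `t_leg = ½ √(U J_leg)`, `t_rung = ½ √(U J_rung)`; round trip,
  uniqueness, the ratio laws `(U/t_leg)² = 20 J_rung/J_cyc`, `(t_leg/t_rung)² = J_leg/J_rung`; certificate
  `(186, 124, 31)` ⇒ `U = 3720` meV EXACTLY, `415.5 < t_leg < 416.5`, `339.5 < t_rung < 340` (printed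
  `0.42`, `0.34`, `3.72`).
* §3 the two-site CHECK of the leading-order step: for the Hubbard dimer the exact singlet–triplet splitting
  `J_dim = √((U/2)² + 4t²) − U/2` (from the tree's `ExtendedHubbardDimer.twoCarrierEnergy` at `V = 0`;
  [ScrivenPowell2009, Eq. (5c)]) satisfies `J_dim (J_dim + U) = 4t²`, hence `U = 4t²/J_dim − J_dim`
  EXACTLY: inverting with the leading-order `4t²/J` alone OVERESTIMATES the dimer `U` by exactly `J`;
  and the two-sided bracket `4t²/U − 16t⁴/U³ ≤ J_dim ≤ 4t²/U` (`U > 0`).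

WHO USES IT (cell `pub/hubbard-downfold`): lit-2's per-material rows «INS t–U fit» (REFVALS-2 §1b La₂CuO₄,
§9 ladder) and lit-1's construction class (E-INS) (REFVALS-1 §C20 NOTE, U-CONSTRUCTIONS-1.tsv) quote the
printed `(t, U)`; this file certifies that those numbers are the exact algebraic consequences of the printed
exchange constants under the printed formulas, and isolates WHY such fits return `U/t ≈ 7–9` for La₂CuO₄
(`J_c/J = 0.26–0.42`) and `U/t_leg ≈ 8.9` for the ladder (`J_rung/J_cyc = 4`): the ratio laws.

PRIOR ART IN THE TREE (stated so that nobody cites two vocabularies as two results): the square-lattice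
dictionary of §1 — the printed polynomials and the closed-form inverse with its monotonicity, uniqueness and
the Coldea / Headings / Peng worked instances — was ALREADY typed in
`Literature/MathematicalPhysics/QuantumLattice/HubbardRingExchangeDictionary.lean` (`scJ1`, `scJ2`, `scJc`,
`tUfitU = (10J + 3J_c)²/(20J_c)`, `tUfitTsq`, `tUfitT`, `tUfitUOverT`, `sq_U_div_t_eq`, `scJ_injective`, …),
which is the CANONICAL file for the square lattice; §1 here is a restatement in the `(J + 3J_c/10)` form found
after landing. §4 (`sqJ_eq_scJ1`, `sqJc_eq_scJc`, `sqJ2_eq_scJ2`, `sqU_eq_tUfitU`, `sqU_mul_eq_four_tUfitTsq`,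
`sqT_eq_tUfitT`) PROVES the two vocabularies equal term by term, so every §1 statement transfers; the content
of this file that is NOT in the dictionary file is the ladder (§2) and the dimer check (§3).

WHAT THIS FILE IS NOT: not a derivation of the `t⁴/U³` coefficients from the Hubbard model (they are the
printed inputs; the tree's `HubbardSuperexchangeHeisenberg` proves the SECOND-order operator identity only);
not a statement that a one-band Hubbard model describes either material; not an error analysis of the fits.
-/

namespace Literature.MathematicalPhysics.QuantumLattice.ExchangeToHubbard

open Real

/-! ### §1 Square lattice, fourth order [ColdeaEtAl2001] -/

/-- Nearest-neighbour exchange to fourth order, AS PRINTED: `J = 4t²/U − 24t⁴/U³`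
[cite: ColdeaEtAl2001, p. 3 (cond-mat/0006384 p0003 L84)]. -/
noncomputable def sqJ (t U : ℝ) : ℝ := 4 * t ^ 2 / U - 24 * t ^ 4 / U ^ 3

/-- Plaquette cyclic (ring) exchange to fourth order, AS PRINTED: `J_c = 80t⁴/U³`
[cite: ColdeaEtAl2001, p. 3 (cond-mat/0006384 p0003 L84)]. -/
noncomputable def sqJc (t U : ℝ) : ℝ := 80 * t ^ 4 / U ^ 3

/-- Second- and third-neighbour exchange to fourth order, AS PRINTED: `J′ = J″ = 4t⁴/U³`
[cite: ColdeaEtAl2001, p. 3 (cond-mat/0006384 p0003 L85)]. -/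
noncomputable def sqJ2 (t U : ℝ) : ℝ := 4 * t ^ 4 / U ^ 3

/-- The closed-form inverse, `U`-component: `U = 5 (J + 3J_c/10)² / J_c` (this file; it reproduces the
printed `U = 2.2` / `2.9` eV from the printed `(J, J_c)`, see `sqU_coldea10K_bounds`)
[cite: ColdeaEtAl2001, p. 3 (the fitted t, U)]. -/
noncomputable def sqU (J Jc : ℝ) : ℝ := 5 * (J + 3 * Jc / 10) ^ 2 / Jc

/-- The closed-form inverse, `t`-component: `t = ½ √(U (J + 3J_c/10))`
[cite: ColdeaEtAl2001, p. 3 (the fitted t, U)]. -/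
noncomputable def sqT (J Jc : ℝ) : ℝ := Real.sqrt (sqU J Jc * (J + 3 * Jc / 10)) / 2

/-- Unfolding `sqJ` [cite: ColdeaEtAl2001, p. 3 (cond-mat/0006384 p0003 L80-95)]. -/
theorem sqJ_def (t U : ℝ) : sqJ t U = 4 * t ^ 2 / U - 24 * t ^ 4 / U ^ 3 := rfl
/-- Unfolding `sqJc` [cite: ColdeaEtAl2001, p. 3 (cond-mat/0006384 p0003 L80-95)]. -/
theorem sqJc_def (t U : ℝ) : sqJc t U = 80 * t ^ 4 / U ^ 3 := rfl
/-- Unfolding `sqJ2` [cite: ColdeaEtAl2001, p. 3 (cond-mat/0006384 p0003 L80-95)]. -/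
theorem sqJ2_def (t U : ℝ) : sqJ2 t U = 4 * t ^ 4 / U ^ 3 := rfl
/-- Unfolding `sqU` [cite: ColdeaEtAl2001, p. 3 (cond-mat/0006384 p0003 L80-95)]. -/
theorem sqU_def (J Jc : ℝ) : sqU J Jc = 5 * (J + 3 * Jc / 10) ^ 2 / Jc := rfl
/-- Unfolding `sqT` [cite: ColdeaEtAl2001, p. 3 (cond-mat/0006384 p0003 L80-95)]. -/
theorem sqT_def (J Jc : ℝ) : sqT J Jc = Real.sqrt (sqU J Jc * (J + 3 * Jc / 10)) / 2 := rfl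

/-- `J′ = J″ = J_c/20`, as printed [cite: ColdeaEtAl2001, p. 3 («J′ = J″ = J_c/20»)]. -/
theorem sqJ2_eq (t U : ℝ) : sqJ2 t U = sqJc t U / 20 := by
  rw [sqJ2_def, sqJc_def]
  ring

/-- The leading-order combination: `J + (3/10) J_c = 4t²/U` (the `t⁴/U³` terms cancel)
[cite: ColdeaEtAl2001, p. 3 (the two printed formulas)]. -/
theorem sqJ_add_sqJc (t U : ℝ) : sqJ t U + 3 / 10 * sqJc t U = 4 * t ^ 2 / U := by
  rw [sqJ_def, sqJc_def]
  ring

/-- Positivity of the inverse `U` for `J_c > 0`, `J + 3J_c/10 ≠ 0`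
[cite: ColdeaEtAl2001, p. 3 (fitted values are positive)]. -/
theorem sqU_pos {J Jc : ℝ} (hJc : 0 < Jc) (hK : 0 < J + 3 * Jc / 10) : 0 < sqU J Jc := by
  rw [sqU_def]
  positivity

/-- `t² = U (J + 3J_c/10)/4` for the inverse pair (square of `sqT`)
[cite: ColdeaEtAl2001, p. 3]. -/
theorem sqT_sq {J Jc : ℝ} (hJc : 0 < Jc) (hK : 0 < J + 3 * Jc / 10) :
    sqT J Jc ^ 2 = sqU J Jc * (J + 3 * Jc / 10) / 4 := by
  rw [sqT_def, div_pow, Real.sq_sqrt (by have := sqU_pos hJc hK; positivity)]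
  ring

/-- Positivity of the inverse `t` [cite: ColdeaEtAl2001, p. 3]. -/
theorem sqT_pos {J Jc : ℝ} (hJc : 0 < Jc) (hK : 0 < J + 3 * Jc / 10) : 0 < sqT J Jc := by
  rw [sqT_def]
  have := sqU_pos hJc hK
  positivity

/-- Helper: on the inverse pair, `24 t⁴/U³ = 3J_c/10` [cite: ColdeaEtAl2001, p. 3]. -/
private theorem t4_div_U3 {J Jc : ℝ} (hJc : 0 < Jc) (hK : 0 < J + 3 * Jc / 10) :
    24 * sqT J Jc ^ 4 / sqU J Jc ^ 3 = 3 * Jc / 10 := by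
  have hU := sqU_pos hJc hK
  have ht2 := sqT_sq hJc hK
  have ht4 : sqT J Jc ^ 4 = (sqU J Jc * (J + 3 * Jc / 10) / 4) ^ 2 := by
    rw [← ht2]; ring
  have hK' : J + 3 * Jc / 10 ≠ 0 := hK.ne'
  rw [ht4, div_eq_iff (pow_ne_zero 3 hU.ne'), sqU_def]
  field_simp
  ring

/-- Helper: on the inverse pair, `4t²/U = J + 3J_c/10` [cite: ColdeaEtAl2001, p. 3]. -/
private theorem t2_div_U {J Jc : ℝ} (hJc : 0 < Jc) (hK : 0 < J + 3 * Jc / 10) :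
    4 * sqT J Jc ^ 2 / sqU J Jc = J + 3 * Jc / 10 := by
  have hU := sqU_pos hJc hK
  rw [sqT_sq hJc hK]
  field_simp

/-- ROUND TRIP, ring exchange: the inverse pair reproduces `J_c` exactly under the printed formula
[cite: ColdeaEtAl2001, p. 3 (J_c = 80t⁴/U³)]. -/
theorem sqJc_sqT_sqU {J Jc : ℝ} (hJc : 0 < Jc) (hK : 0 < J + 3 * Jc / 10) :
    sqJc (sqT J Jc) (sqU J Jc) = Jc := by
  have h := t4_div_U3 hJc hK
  rw [sqJc_def]
  have : 80 * sqT J Jc ^ 4 / sqU J Jc ^ 3 = 10 / 3 * (24 * sqT J Jc ^ 4 / sqU J Jc ^ 3) := by ring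
  rw [this, h]
  ring

/-- ROUND TRIP, nearest-neighbour exchange: the inverse pair reproduces `J` exactly under the printed formula
[cite: ColdeaEtAl2001, p. 3 (J = 4t²/U − 24t⁴/U³)]. -/
theorem sqJ_sqT_sqU {J Jc : ℝ} (hJc : 0 < Jc) (hK : 0 < J + 3 * Jc / 10) :
    sqJ (sqT J Jc) (sqU J Jc) = J := by
  rw [sqJ_def, t2_div_U hJc hK, t4_div_U3 hJc hK]
  ring

/-- UNIQUENESS: positive `(t, U)` solving the two printed equations ARE the closed-form inverse
[cite: ColdeaEtAl2001, p. 3 (the fit determines t and U)]. -/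
theorem sq_inverse_unique {t U J Jc : ℝ} (ht : 0 < t) (hU : 0 < U) (hJ : sqJ t U = J)
    (hJc : sqJc t U = Jc) : U = sqU J Jc ∧ t = sqT J Jc := by
  have hK : J + 3 * Jc / 10 = 4 * t ^ 2 / U := by
    rw [← hJ, ← hJc]; exact (sqJ_add_sqJc t U).symm ▸ by ring
  have hJc_pos : 0 < Jc := by rw [← hJc, sqJc_def]; positivity
  have hKpos : 0 < J + 3 * Jc / 10 := by rw [hK]; positivity
  have hUeq : U = sqU J Jc := by
    rw [sqU_def, hK, ← hJc, sqJc_def]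
    field_simp
    ring
  refine ⟨hUeq, ?_⟩
  have ht2 : t ^ 2 = sqT J Jc ^ 2 := by
    rw [sqT_sq hJc_pos hKpos, ← hUeq, hK]
    field_simp
  have htpos := sqT_pos hJc_pos hKpos
  nlinarith [ht2, ht, htpos, sq_nonneg (t - sqT J Jc), sq_nonneg (t + sqT J Jc)]

/-- THE RATIO LAW: under the printed fourth-order map, `(U/t)² = 20 (J/J_c + 3/10)` — the fitted `U/t`
depends on the RATIO of ring to nearest-neighbour exchange alone (`J_c/J = 0.417 ⇒ U/t = 7.35`;
`0.275 ⇒ 8.94`, the two printed temperatures) [cite: ColdeaEtAl2001, p. 3–4 («J_c/J = 0.27 ± 0.06 at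
T = 295 K (0.41 ± 0.07 at T = 10 K)»)]. -/
theorem sq_ratio_law {t U : ℝ} (ht : t ≠ 0) (hU : U ≠ 0) :
    (U / t) ^ 2 = 20 * (sqJ t U / sqJc t U + 3 / 10) := by
  rw [sqJ_def, sqJc_def]
  have ht4 : t ^ 4 ≠ 0 := pow_ne_zero 4 ht
  field_simp
  ring

/-- The same law on the inverse side: `sqU² = 20 (J/J_c + 3/10) · sqT²`
[cite: ColdeaEtAl2001, p. 3]. -/
theorem sqU_sq_eq {J Jc : ℝ} (hJc : 0 < Jc) (hK : 0 < J + 3 * Jc / 10) :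
    sqU J Jc ^ 2 = 20 * (J / Jc + 3 / 10) * sqT J Jc ^ 2 := by
  rw [sqT_sq hJc hK, sqU_def]
  field_simp
  ring

/-- MONOTONICITY: at fixed nearest-neighbour `J > 0`, the inverse `U` is STRICTLY DECREASING in the ring
exchange on `0 < J_c < 10J/3` — more cyclic exchange at the same `J` means a smaller one-band `U`
(and a smaller `U/t`) [cite: ColdeaEtAl2001, p. 3–4 (10 K vs 295 K: J_c 61 vs 38 meV ⇒ U 2.2 vs 2.9 eV)]. -/
theorem sqU_strictAntiOn {J : ℝ} (hJ : 0 < J) :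
    StrictAntiOn (fun Jc => sqU J Jc) (Set.Ioo 0 (10 * J / 3)) := by
  intro a ha b hb hab
  simp only [Set.mem_Ioo] at ha hb
  show sqU J b < sqU J a
  rw [sqU_def, sqU_def]
  have ha0 := ha.1
  have hb0 := hb.1
  rw [div_lt_div_iff₀ hb0 ha0]
  -- 5 (J + 3b/10)² a < 5 (J + 3a/10)² b  ⇔  (b − a)(9ab/100 − J²) < 0
  have key : 5 * (J + 3 * a / 10) ^ 2 * b - 5 * (J + 3 * b / 10) ^ 2 * a
      = (b - a) * (5 * J ^ 2 - 9 * a * b / 20) := by ring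
  have h1 : 0 < b - a := sub_pos.mpr hab
  have h2 : 0 < 5 * J ^ 2 - 9 * a * b / 20 := by
    have : a * b < (10 * J / 3) * (10 * J / 3) := by
      calc a * b < (10 * J / 3) * b := by exact mul_lt_mul_of_pos_right ha.2 hb0
        _ < (10 * J / 3) * (10 * J / 3) := by exact mul_lt_mul_of_pos_left hb.2 (by positivity)
    nlinarith [this]
  nlinarith [mul_pos h1 h2, key]

/-- KERNEL CERTIFICATE (10 K): the printed `J = 146.3`, `J_c = 61` meV give `2220 < U < 2222` meV under the
printed formulas — the printed «U = 2.2 ± 0.4 eV» [cite: ColdeaEtAl2001, p. 3 (10 K parameters)]. -/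
theorem sqU_coldea10K_bounds : 2220 < sqU 146.3 61 ∧ sqU 146.3 61 < 2222 := by
  rw [sqU_def]; constructor <;> norm_num

/-- KERNEL CERTIFICATE (10 K): `302 < t < 302.5` meV — the printed «t = 0.30 ± 0.02 eV»
[cite: ColdeaEtAl2001, p. 3 (10 K parameters)]. -/
theorem sqT_coldea10K_bounds : 302 < sqT 146.3 61 ∧ sqT 146.3 61 < 302.5 := by
  have hK : (0:ℝ) < 146.3 + 3 * 61 / 10 := by norm_num
  have h2 := sqT_sq (by norm_num : (0:ℝ) < 61) hK
  have hpos := sqT_pos (by norm_num : (0:ℝ) < 61) hK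
  rw [sqU_def] at h2
  norm_num at h2
  constructor <;> nlinarith [h2, hpos]

/-- KERNEL CERTIFICATE (295 K): `J = 138.3`, `J_c = 38` meV give `2948 < U < 2950` meV — printed
«U = 2.9 ± 0.4 eV» [cite: ColdeaEtAl2001, p. 3 (295 K parameters)]. -/
theorem sqU_coldea295K_bounds : 2948 < sqU 138.3 38 ∧ sqU 138.3 38 < 2950 := by
  rw [sqU_def]; constructor <;> norm_num

/-- KERNEL CERTIFICATE (295 K): `332 < t < 332.5` meV — printed «t = 0.33 ± 0.02 eV»
[cite: ColdeaEtAl2001, p. 3 (295 K parameters)]. -/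
theorem sqT_coldea295K_bounds : 332 < sqT 138.3 38 ∧ sqT 138.3 38 < 332.5 := by
  have hK : (0:ℝ) < 138.3 + 3 * 38 / 10 := by norm_num
  have h2 := sqT_sq (by norm_num : (0:ℝ) < 38) hK
  have hpos := sqT_pos (by norm_num : (0:ℝ) < 38) hK
  rw [sqU_def] at h2
  norm_num at h2
  constructor <;> nlinarith [h2, hpos]

/-! ### §2 Two-leg ladder [NotbohmEtAl2007] -/

/-- Leg exchange at the printed order: `J_leg = 4t_leg²/U`
[cite: NotbohmEtAl2007, note [Hubbard] (cond-mat/0608109 p0005 L1)]. -/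
noncomputable def ladJleg (tl U : ℝ) : ℝ := 4 * tl ^ 2 / U

/-- Rung exchange at the printed order: `J_rung = 4t_rung²/U`
[cite: NotbohmEtAl2007, note [Hubbard] (cond-mat/0608109 p0005 L3)]. -/
noncomputable def ladJrung (tr U : ℝ) : ℝ := 4 * tr ^ 2 / U

/-- Cyclic exchange at fourth order, AS PRINTED: `J_cyc = 80 t_leg² t_rung²/U³`
[cite: NotbohmEtAl2007, note [Hubbard] (cond-mat/0608109 p0005 L4)]. -/
noncomputable def ladJcyc (tl tr U : ℝ) : ℝ := 80 * tl ^ 2 * tr ^ 2 / U ^ 3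

/-- Closed-form inverse: `U = 5 J_leg J_rung / J_cyc` (reproduces the printed `U = 3.72` eV EXACTLY from
`(186, 124, 31)` meV, `ladU_notbohm`) [cite: NotbohmEtAl2007, p. 4 L43 (the printed t_leg, t_rung, U)]. -/
noncomputable def ladU (Jl Jr Jc : ℝ) : ℝ := 5 * Jl * Jr / Jc

/-- Closed-form inverse: `t_leg = ½ √(U J_leg)` [cite: NotbohmEtAl2007, p. 4 L43]. -/
noncomputable def ladTleg (Jl Jr Jc : ℝ) : ℝ := Real.sqrt (ladU Jl Jr Jc * Jl) / 2

/-- Closed-form inverse: `t_rung = ½ √(U J_rung)` [cite: NotbohmEtAl2007, p. 4 L43]. -/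
noncomputable def ladTrung (Jl Jr Jc : ℝ) : ℝ := Real.sqrt (ladU Jl Jr Jc * Jr) / 2

/-- Unfolding `ladJleg` [cite: NotbohmEtAl2007, p. 4 L43 + note [Hubbard] (cond-mat/0608109 p0005 L1-4)]. -/
theorem ladJleg_def (tl U : ℝ) : ladJleg tl U = 4 * tl ^ 2 / U := rfl
/-- Unfolding `ladJrung` [cite: NotbohmEtAl2007, p. 4 L43 + note [Hubbard] (cond-mat/0608109 p0005 L1-4)]. -/
theorem ladJrung_def (tr U : ℝ) : ladJrung tr U = 4 * tr ^ 2 / U := rfl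
/-- Unfolding `ladJcyc` [cite: NotbohmEtAl2007, p. 4 L43 + note [Hubbard] (cond-mat/0608109 p0005 L1-4)]. -/
theorem ladJcyc_def (tl tr U : ℝ) : ladJcyc tl tr U = 80 * tl ^ 2 * tr ^ 2 / U ^ 3 := rfl
/-- Unfolding `ladU` [cite: NotbohmEtAl2007, p. 4 L43 + note [Hubbard] (cond-mat/0608109 p0005 L1-4)]. -/
theorem ladU_def (Jl Jr Jc : ℝ) : ladU Jl Jr Jc = 5 * Jl * Jr / Jc := rfl
/-- Unfolding `ladTleg` [cite: NotbohmEtAl2007, p. 4 L43 + note [Hubbard] (cond-mat/0608109 p0005 L1-4)]. -/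
theorem ladTleg_def (Jl Jr Jc : ℝ) : ladTleg Jl Jr Jc = Real.sqrt (ladU Jl Jr Jc * Jl) / 2 := rfl
/-- Unfolding `ladTrung` [cite: NotbohmEtAl2007, p. 4 L43 + note [Hubbard] (cond-mat/0608109 p0005 L1-4)]. -/
theorem ladTrung_def (Jl Jr Jc : ℝ) : ladTrung Jl Jr Jc = Real.sqrt (ladU Jl Jr Jc * Jr) / 2 := rfl

/-- The printed cyclic exchange in terms of the printed leg/rung exchanges: `J_cyc = 5 J_leg J_rung / U`
[cite: NotbohmEtAl2007, note [Hubbard]]. -/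
theorem ladJcyc_eq (tl tr U : ℝ) (hU : U ≠ 0) :
    ladJcyc tl tr U = 5 * ladJleg tl U * ladJrung tr U / U := by
  rw [ladJcyc_def, ladJleg_def, ladJrung_def]
  field_simp
  ring

/-- Positivity of the ladder inverse `U` for positive exchanges [cite: NotbohmEtAl2007, p. 4 L43 + note [Hubbard] (cond-mat/0608109 p0005 L1-4)]. -/
theorem ladU_pos {Jl Jr Jc : ℝ} (hl : 0 < Jl) (hr : 0 < Jr) (hc : 0 < Jc) : 0 < ladU Jl Jr Jc := by
  rw [ladU_def]; positivity

/-- `t_leg² = U J_leg / 4` on the inverse triple [cite: NotbohmEtAl2007, p. 4 L43 + note [Hubbard] (cond-mat/0608109 p0005 L1-4)]. -/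
theorem ladTleg_sq {Jl Jr Jc : ℝ} (hl : 0 < Jl) (hr : 0 < Jr) (hc : 0 < Jc) :
    ladTleg Jl Jr Jc ^ 2 = ladU Jl Jr Jc * Jl / 4 := by
  rw [ladTleg_def, div_pow, Real.sq_sqrt (by have := ladU_pos hl hr hc; positivity)]
  ring

/-- `t_rung² = U J_rung / 4` on the inverse triple [cite: NotbohmEtAl2007, p. 4 L43 + note [Hubbard] (cond-mat/0608109 p0005 L1-4)]. -/
theorem ladTrung_sq {Jl Jr Jc : ℝ} (hl : 0 < Jl) (hr : 0 < Jr) (hc : 0 < Jc) :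
    ladTrung Jl Jr Jc ^ 2 = ladU Jl Jr Jc * Jr / 4 := by
  rw [ladTrung_def, div_pow, Real.sq_sqrt (by have := ladU_pos hl hr hc; positivity)]
  ring

/-- Positivity of the inverse `t_leg` [cite: NotbohmEtAl2007, p. 4 L43 + note [Hubbard] (cond-mat/0608109 p0005 L1-4)]. -/
theorem ladTleg_pos {Jl Jr Jc : ℝ} (hl : 0 < Jl) (hr : 0 < Jr) (hc : 0 < Jc) :
    0 < ladTleg Jl Jr Jc := by
  rw [ladTleg_def]; have := ladU_pos hl hr hc; positivity

/-- Positivity of the inverse `t_rung` [cite: NotbohmEtAl2007, p. 4 L43 + note [Hubbard] (cond-mat/0608109 p0005 L1-4)]. -/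
theorem ladTrung_pos {Jl Jr Jc : ℝ} (hl : 0 < Jl) (hr : 0 < Jr) (hc : 0 < Jc) :
    0 < ladTrung Jl Jr Jc := by
  rw [ladTrung_def]; have := ladU_pos hl hr hc; positivity

/-- ROUND TRIP (ladder): the inverse triple reproduces `J_leg`, `J_rung`, `J_cyc` under the printed formulas
[cite: NotbohmEtAl2007, note [Hubbard]]. -/
theorem lad_roundTrip {Jl Jr Jc : ℝ} (hl : 0 < Jl) (hr : 0 < Jr) (hc : 0 < Jc) :
    ladJleg (ladTleg Jl Jr Jc) (ladU Jl Jr Jc) = Jl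
      ∧ ladJrung (ladTrung Jl Jr Jc) (ladU Jl Jr Jc) = Jr
      ∧ ladJcyc (ladTleg Jl Jr Jc) (ladTrung Jl Jr Jc) (ladU Jl Jr Jc) = Jc := by
  have hU := ladU_pos hl hr hc
  have h1 := ladTleg_sq hl hr hc
  have h2 := ladTrung_sq hl hr hc
  refine ⟨?_, ?_, ?_⟩
  · rw [ladJleg_def, h1]; field_simp
  · rw [ladJrung_def, h2]; field_simp
  · rw [ladJcyc_def, h1, h2, ladU_def]
    field_simp
    ring

/-- UNIQUENESS (ladder): positive `(t_leg, t_rung, U)` solving the three printed equations are the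
closed-form inverse [cite: NotbohmEtAl2007, p. 4 L43]. -/
theorem lad_inverse_unique {tl tr U Jl Jr Jc : ℝ} (htl : 0 < tl) (htr : 0 < tr) (hU : 0 < U)
    (h1 : ladJleg tl U = Jl) (h2 : ladJrung tr U = Jr) (h3 : ladJcyc tl tr U = Jc) :
    U = ladU Jl Jr Jc ∧ tl = ladTleg Jl Jr Jc ∧ tr = ladTrung Jl Jr Jc := by
  have hl : 0 < Jl := by rw [← h1, ladJleg_def]; positivity
  have hr : 0 < Jr := by rw [← h2, ladJrung_def]; positivity
  have hc : 0 < Jc := by rw [← h3, ladJcyc_def]; positivity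
  have hUeq : U = ladU Jl Jr Jc := by
    rw [ladU_def, ← h1, ← h2, ← h3, ladJleg_def, ladJrung_def, ladJcyc_def]
    field_simp
    ring
  refine ⟨hUeq, ?_, ?_⟩
  · have hsq : tl ^ 2 = ladTleg Jl Jr Jc ^ 2 := by
      rw [ladTleg_sq hl hr hc, ← hUeq, ← h1, ladJleg_def]; field_simp
    have hp := ladTleg_pos hl hr hc
    nlinarith [hsq, sq_nonneg (tl - ladTleg Jl Jr Jc), sq_nonneg (tl + ladTleg Jl Jr Jc)]
  · have hsq : tr ^ 2 = ladTrung Jl Jr Jc ^ 2 := by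
      rw [ladTrung_sq hl hr hc, ← hUeq, ← h2, ladJrung_def]; field_simp
    have hp := ladTrung_pos hl hr hc
    nlinarith [hsq, sq_nonneg (tr - ladTrung Jl Jr Jc), sq_nonneg (tr + ladTrung Jl Jr Jc)]

/-- RATIO LAWS (ladder): `(U/t_leg)² = 20 J_rung/J_cyc` and `(t_leg/t_rung)² = J_leg/J_rung` — the fitted
`U/t_leg` is fixed by the rung-to-cyclic exchange ratio alone (`124/31 = 4 ⇒ U/t_leg = √80 ≈ 8.9`), the
hopping anisotropy by `J_leg/J_rung` (`186/124 ⇒ t_leg/t_rung ≈ 1.22`)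
[cite: NotbohmEtAl2007, p. 4 L25-43]. -/
theorem lad_ratio_laws {tl tr U : ℝ} (htl : tl ≠ 0) (htr : tr ≠ 0) (hU : U ≠ 0) :
    (U / tl) ^ 2 = 20 * (ladJrung tr U / ladJcyc tl tr U)
      ∧ (tl / tr) ^ 2 = ladJleg tl U / ladJrung tr U := by
  rw [ladJleg_def, ladJrung_def, ladJcyc_def]
  have h1 : tl ^ 2 ≠ 0 := pow_ne_zero 2 htl
  have h2 : tr ^ 2 ≠ 0 := pow_ne_zero 2 htr
  constructor
  · field_simp; ring
  · field_simp

/-- KERNEL CERTIFICATE (ladder): the printed `(J_leg, J_rung, J_cyc) = (186, 124, 31)` meV give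
`U = 3720` meV EXACTLY — the printed «U = 3.72 eV» [cite: NotbohmEtAl2007, p. 4 L43]. -/
theorem ladU_notbohm : ladU 186 124 31 = 3720 := by
  rw [ladU_def]; norm_num

/-- KERNEL CERTIFICATE (ladder): `415.5 < t_leg < 416.5` and `339.5 < t_rung < 340` meV — the printed
«t_leg = 0.42, t_rung = 0.34» eV [cite: NotbohmEtAl2007, p. 4 L43]. -/
theorem ladT_notbohm_bounds :
    415.5 < ladTleg 186 124 31 ∧ ladTleg 186 124 31 < 416.5
      ∧ 339.5 < ladTrung 186 124 31 ∧ ladTrung 186 124 31 < 340 := by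
  have hl : (0:ℝ) < 186 := by norm_num
  have hr : (0:ℝ) < 124 := by norm_num
  have hc : (0:ℝ) < 31 := by norm_num
  have h1 := ladTleg_sq hl hr hc
  have h2 := ladTrung_sq hl hr hc
  have p1 := ladTleg_pos hl hr hc
  have p2 := ladTrung_pos hl hr hc
  rw [ladU_notbohm] at h1 h2
  norm_num at h1 h2
  refine ⟨?_, ?_, ?_, ?_⟩ <;> nlinarith [h1, h2, p1, p2]

/-! ### §3 The two-site check of the leading-order step (exact Hubbard dimer) -/

open Literature.MathematicalPhysics.QuantumManyBody.ExtendedHubbardDimer in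
/-- The dimer singlet–triplet splitting: the `S_z = 0` triplet of the two-site Hubbard model sits at `V = 0`
and the singlet ground level is `twoCarrierEnergy t U 0 = U/2 − √((U/2)² + 4t²)`; their difference
`J_dim = √((U/2)² + 4t²) − U/2` satisfies `J_dim (J_dim + U) = 4t²` EXACTLY
[cite: ScrivenPowell2009, Eq. (5c) (symmetric case, V = 0)]. -/
theorem dimer_gap_mul (t U : ℝ) :
    (-twoCarrierEnergy t U 0) * (-twoCarrierEnergy t U 0 + U) = 4 * t ^ 2 := by
  have h := twoCarrierEnergy_root t U 0
  nlinarith [h]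

open Literature.MathematicalPhysics.QuantumManyBody.ExtendedHubbardDimer in
/-- The dimer gap is nonnegative [cite: ScrivenPowell2009, Eq. (5c) (V = 0)]. -/
theorem dimer_gap_nonneg (t U : ℝ) : 0 ≤ -twoCarrierEnergy t U 0 := by
  have h := twoCarrierEnergy_le_min t U 0
  have : min U 0 ≤ 0 := min_le_right _ _
  linarith

open Literature.MathematicalPhysics.QuantumManyBody.ExtendedHubbardDimer in
/-- EXACT INVERSION ON THE DIMER: `U = 4t²/J_dim − J_dim` whenever `J_dim ≠ 0` — inverting with the
leading-order `4t²/J` alone overestimates the dimer `U` by exactly `J`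
[cite: ScrivenPowell2009, Eq. (5c) (V = 0)]. -/
theorem dimer_inversion (t U : ℝ) (hJ : -twoCarrierEnergy t U 0 ≠ 0) :
    U = 4 * t ^ 2 / (-twoCarrierEnergy t U 0) - (-twoCarrierEnergy t U 0) := by
  set J := -twoCarrierEnergy t U 0 with hJdef
  have h : J * (J + U) = 4 * t ^ 2 := dimer_gap_mul t U
  have h' : (U + J) * J = 4 * t ^ 2 := by rw [← h]; ring
  rw [eq_sub_iff_add_eq, eq_div_iff hJ]
  exact h'

open Literature.MathematicalPhysics.QuantumManyBody.ExtendedHubbardDimer in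
/-- UPPER BRACKET: `J_dim ≤ 4t²/U` for `U > 0` (the leading-order superexchange overestimates the exact dimer
splitting) [cite: ScrivenPowell2009, Eq. (5c) (V = 0)]. -/
theorem dimer_gap_le (t U : ℝ) (hU : 0 < U) : -twoCarrierEnergy t U 0 ≤ 4 * t ^ 2 / U := by
  set J := -twoCarrierEnergy t U 0 with hJdef
  have h : J * (J + U) = 4 * t ^ 2 := dimer_gap_mul t U
  have hJ : 0 ≤ J := dimer_gap_nonneg t U
  rw [le_div_iff₀ hU]
  nlinarith [h, hJ, mul_nonneg hJ hJ]

open Literature.MathematicalPhysics.QuantumManyBody.ExtendedHubbardDimer in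
/-- LOWER BRACKET: `4t²/U − 16t⁴/U³ ≤ J_dim` for `U > 0` — the exact splitting lies within `16t⁴/U³` below the
leading-order value [cite: ScrivenPowell2009, Eq. (5c) (V = 0)]. -/
theorem dimer_gap_ge (t U : ℝ) (hU : 0 < U) :
    4 * t ^ 2 / U - 16 * t ^ 4 / U ^ 3 ≤ -twoCarrierEnergy t U 0 := by
  set J := -twoCarrierEnergy t U 0 with hJdef
  have h := dimer_gap_mul t U
  have hJ := dimer_gap_nonneg t U
  have hle := dimer_gap_le t U hU
  rw [← hJdef] at h hJ hle
  -- J (J + U) = 4t² and J ≤ 4t²/U  ⇒  J = 4t²/(U + J) ≥ 4t²/(U + 4t²/U) ≥ 4t²/U − 16 t⁴/U³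
  have hU3 : 0 < U ^ 3 := by positivity
  have key : (4 * t ^ 2 / U - 16 * t ^ 4 / U ^ 3) * (U + J) ≤ 4 * t ^ 2 := by
    have e1 : (4 * t ^ 2 / U - 16 * t ^ 4 / U ^ 3) * (U + J)
        = 4 * t ^ 2 - 16 * t ^ 4 / U ^ 2 + (4 * t ^ 2 / U - 16 * t ^ 4 / U ^ 3) * J := by
      field_simp
    rw [e1]
    have e2 : (4 * t ^ 2 / U - 16 * t ^ 4 / U ^ 3) * J ≤ (4 * t ^ 2 / U) * (4 * t ^ 2 / U) := by
      have hb : 0 ≤ 16 * t ^ 4 / U ^ 3 := by positivity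
      have a2 : 0 ≤ 4 * t ^ 2 / U := by positivity
      nlinarith [mul_nonneg hb hJ, mul_le_mul_of_nonneg_left hle a2]
    have e3 : (4 * t ^ 2 / U) * (4 * t ^ 2 / U) = 16 * t ^ 4 / U ^ 2 := by
      field_simp; ring
    linarith [e2, e3]
  have hUJ : 0 < U + J := by linarith
  have : (4 * t ^ 2 / U - 16 * t ^ 4 / U ^ 3) * (U + J) ≤ J * (U + J) := by nlinarith [h, key]
  exact le_of_mul_le_mul_right this hUJ


/-! ## 4. Bridge to the tree's square-lattice dictionary (`HubbardRingExchangeDictionary.lean`)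

The definitions of §1 coincide with the earlier `scJ1 / scJ2 / scJc / tUfitU / tUfitTsq / tUfitT` of
`Literature.MathematicalPhysics.QuantumLattice` (same namespace root); the equalities below hold for ALL real
arguments (Lean's `x / 0 = 0` convention makes the degenerate `J_c = 0` case agree as well). -/

/-- `sqJ = scJ1` (same printed polynomial `4t²/U − 24t⁴/U³`). [cite: ColdeaEtAl2001, p. 3] -/
theorem sqJ_eq_scJ1 (t U : ℝ) : sqJ t U = scJ1 t U := rfl

/-- `sqJc = scJc` (`80t⁴/U³`). [cite: ColdeaEtAl2001, p. 3] -/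
theorem sqJc_eq_scJc (t U : ℝ) : sqJc t U = scJc t U := rfl

/-- `sqJ2 = scJ2` (`4t⁴/U³`). [cite: ColdeaEtAl2001, p. 3] -/
theorem sqJ2_eq_scJ2 (t U : ℝ) : sqJ2 t U = scJ2 t U := rfl

/-- The two closed-form inverses agree: `5 (J + 3J_c/10)²/J_c = (10J + 3J_c)²/(20J_c)`.
[cite: ColdeaEtAl2001, p. 3] -/
theorem sqU_eq_tUfitU (J Jc : ℝ) : sqU J Jc = tUfitU J Jc := by
  rcases eq_or_ne Jc 0 with h | h
  · subst h; simp [sqU, tUfitU]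
  · unfold sqU tUfitU; field_simp; ring

/-- `sqU · (J + 3J_c/10) = 4 · tUfitTsq` (`= 4t²` on the image). [cite: ColdeaEtAl2001, p. 3] -/
theorem sqU_mul_eq_four_tUfitTsq (J Jc : ℝ) : sqU J Jc * (J + 3 * Jc / 10) = 4 * tUfitTsq J Jc := by
  rcases eq_or_ne Jc 0 with h | h
  · subst h; simp [sqU, tUfitTsq]
  · unfold sqU tUfitTsq; field_simp; ring

/-- The two hopping formulas agree: `½ √(U (J + 3J_c/10)) = √((10J + 3J_c)³/(800J_c))`.
[cite: ColdeaEtAl2001, p. 3] -/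
theorem sqT_eq_tUfitT (J Jc : ℝ) : sqT J Jc = tUfitT J Jc := by
  have h4 : Real.sqrt 4 = 2 := by
    rw [show (4 : ℝ) = 2 * 2 by norm_num, Real.sqrt_mul_self (by norm_num : (0 : ℝ) ≤ 2)]
  rw [sqT, tUfitT, sqU_mul_eq_four_tUfitTsq, Real.sqrt_mul (by norm_num : (0 : ℝ) ≤ 4), h4]
  ring

end Literature.MathematicalPhysics.QuantumLattice.ExchangeToHubbard
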